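import Summits.CriticalPhenomena.CardyFormulaZ2.Theorems.CardyIKTransportIKLinearTransportScreeningArray2

/-!
# The multiplicative offset lemma `screeningOffsetMul`

Support file (`--supports stmt-CriticalPhenomena-5076`) proving the registered stub `screeningOffsetMul`
(sub-goal 1/3 of the skeleton stub `stub_RatioMix`) of the line `pinned-diagram-exchange`
(crux `IKLinearTransport`).  It is the MULTIPLICATIVE companion of the landed additive offset lemma
`ScreeningArray.screeningOffset` (file `…ScreeningArray2`): on the `(w + 2n - 1) × (h + 2n - 1)` array of
independent biased bits (column bias `p c`, `|1 - 2 p c| ≤ θ < 1`), XOR-ing the box data with an additive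
pattern `A i ⊕ B j` multiplies the expectation of a NONNEGATIVE statistic `G` by at most
`((1 + θ^n) / (1 - θ^n))^(w + h)`.
* `flip_lemma_mul`: one block-parity flip, `|E[G(D)] - E[G(D ⊕ P)]| ≤ |∏_{f ∈ Bk} (1 - 2 p_{f.1})| (E[G(D)] + E[G(D ⊕ P)])`
  (write `G(D q) ∓ G(D q ⊕ P) = χ_{Bk}(q) K(q)`, resp. `K⁺(q)`, with `K, K⁺` not reading `Bk`, `|K| ≤ K⁺`).
* `le_ratio_mul_of_abs_sub_le`: `|X - Y| ≤ ρ (X + Y)`, `ρ ≤ τ < 1` give `Y ≤ (1 + τ)/(1 - τ) · X`.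
* `colFlip_cost_mul` / `rowFlip_cost_mul`: one prefix flip `[i ≤ t]` / `[j ≤ t]` costs the factor
  `(1 + θ^n)/(1 - θ^n)` (blocks of `≥ n` entries, `boxData_block`, `colBlock_card`, `rowBlock_card`).
* `chain_flips_mul`: multiplicative telescoping over prefix flips, factor `R ^ L`.
* `screeningOffsetMul`: `w` column flips, then `h` row flips.
-/

noncomputable section

namespace Summit.CriticalPhenomena.CardyFormulaZ2.Theorems.IKLinearTransport.PinnedDiagramExchange.ScreeningAssembly

open Finset ScreeningArray

variable {m k : ℕ}

/-! ## Linear-algebra helpers for `arrSum` -/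

/-- `arrSum` is linear: sums. [folklore] -/
theorem arrSum_add_eq (p : Fin m → ℝ) (H H' : (Fin m × Fin k → Bool) → ℝ) :
    arrSum p H + arrSum p H' = arrSum p (fun q => H q + H' q) := by
  unfold arrSum
  rw [← Finset.sum_add_distrib]
  exact Finset.sum_congr rfl fun q _ => by ring

/-- `arrSum` of a nonnegative function is nonnegative (biases in `[0, 1]`). [folklore] -/
theorem arrSum_nonneg_of_nonneg (p : Fin m → ℝ) (hp : ∀ c, 0 ≤ p c ∧ p c ≤ 1)
    (H : (Fin m × Fin k → Bool) → ℝ) (hH : ∀ q, 0 ≤ H q) : 0 ≤ arrSum p H := by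
  unfold arrSum
  exact Finset.sum_nonneg fun q _ => mul_nonneg (arrWeight_nonneg p hp q) (hH q)

/-- Monotonicity of `arrSum` in absolute value: `|H| ≤ H'` pointwise gives `|E[H]| ≤ E[H']`. [folklore] -/
theorem abs_arrSum_le_arrSum_of_abs_le (p : Fin m → ℝ) (hp : ∀ c, 0 ≤ p c ∧ p c ≤ 1)
    (H H' : (Fin m × Fin k → Bool) → ℝ) (hH : ∀ q, |H q| ≤ H' q) : |arrSum p H| ≤ arrSum p H' := by
  unfold arrSum
  calc |∑ q, arrWeight p q * H q| ≤ ∑ q, |arrWeight p q * H q| := abs_sum_le_sum_abs _ _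
    _ ≤ ∑ q : Fin m × Fin k → Bool, arrWeight p q * H' q := Finset.sum_le_sum fun q _ => by
        rw [abs_mul, abs_of_nonneg (arrWeight_nonneg p hp q)]
        exact mul_le_mul_of_nonneg_left (hH q) (arrWeight_nonneg p hp q)

/-- Elementary ratio bound: `0 ≤ X, Y`, `|X - Y| ≤ ρ (X + Y)` and `ρ ≤ τ < 1` give
`Y ≤ (1 + τ) / (1 - τ) · X`. [folklore] -/
theorem le_ratio_mul_of_abs_sub_le {X Y ρ τ : ℝ} (hX : 0 ≤ X) (hY : 0 ≤ Y)
    (hXY : |X - Y| ≤ ρ * (X + Y)) (hρτ : ρ ≤ τ) (hτ1 : τ < 1) : Y ≤ (1 + τ) / (1 - τ) * X := by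
  have h1 : Y - X ≤ τ * (X + Y) := by
    have h2 := (abs_le.mp hXY).1
    have h3 := mul_le_mul_of_nonneg_right hρτ (add_nonneg hX hY)
    linarith
  rw [div_mul_eq_mul_div, le_div_iff₀ (sub_pos.mpr hτ1)]
  linarith

/-! ## The multiplicative flip lemma -/

/-- MULTIPLICATIVE FLIP LEMMA. If the data `D q` reads the block `Bk` only through its parity, a parity change
XOR-ing the data with the fixed pattern `P`, then for every NONNEGATIVE `G`,
`|E[G(D q)] - E[G(D q ⊕ P)]| ≤ |∏_{f ∈ Bk} (1 - 2 p_{f.1})| · (E[G(D q)] + E[G(D q ⊕ P)])`. [folklore] -/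
theorem flip_lemma_mul (p : Fin m → ℝ) (hp : ∀ c, 0 ≤ p c ∧ p c ≤ 1) (Bk : Finset (Fin m × Fin k))
    (f₀ : Fin m × Fin k) (hf₀ : f₀ ∈ Bk) {δ : Type*} (D : (Fin m × Fin k → Bool) → δ → Bool) (P : δ → Bool)
    (hD : ∀ q q' : Fin m × Fin k → Bool, (∀ f ∉ Bk, q f = q' f) →
      D q' = if parS Bk q' = parS Bk q then D q else fun d => xor (D q d) (P d))
    (G : (δ → Bool) → ℝ) (hG : ∀ x, 0 ≤ G x) :
    |arrSum p (fun q => G (D q)) - arrSum p (fun q => G (fun d => xor (D q d) (P d)))| ≤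
      |∏ f ∈ Bk, (1 - 2 * p f.1)| *
        (arrSum p (fun q => G (D q)) + arrSum p (fun q => G (fun d => xor (D q d) (P d)))) := by
  -- adapted from `ScreeningArray.flip_lemma` (…ScreeningArray2): reference configurations `setB q b`,
  -- equal to `q` off the block and of block parity `b`
  set setB : (Fin m × Fin k → Bool) → Bool → (Fin m × Fin k → Bool) :=
    fun q b f => if f = f₀ then b else if f ∈ Bk then false else q f with hsetB
  have hagree : ∀ q b, ∀ f ∉ Bk, q f = setB q b f := by
    intro q b f hf
    have h1 : f ≠ f₀ := fun h => hf (h ▸ hf₀)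
    simp [hsetB, h1, hf]
  have hfilter : ∀ q b, (Bk.filter fun f => setB q b f = true) = if b then {f₀} else ∅ := by
    intro q b
    ext f
    by_cases h1 : f = f₀
    · subst h1
      cases b <;> simp [hsetB, hf₀]
    · by_cases h2 : f ∈ Bk
      · cases b <;> simp [hsetB, h1, h2]
      · cases b <;> simp [hsetB, h1, h2]
  have hpar : ∀ q b, parS Bk (setB q b) = b := by
    intro q b
    unfold parS
    rw [hfilter]
    cases b <;> simp
  have hinv : ∀ f ∈ Bk, ∀ q b v, setB (Function.update q f v) b = setB q b := by
    intro f hf q b v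
    funext f'
    by_cases h1 : f' = f₀
    · simp [hsetB, h1]
    · by_cases h2 : f' ∈ Bk
      · simp [hsetB, h1, h2]
      · have h3 : f' ≠ f := fun h => h2 (h ▸ hf)
        simp [hsetB, h1, h2, Function.update_of_ne h3]
  -- the Walsh coefficient `K` and the symmetric companion `Kp`, neither reading the block
  set K : (Fin m × Fin k → Bool) → ℝ := fun q => G (D (setB q false)) - G (D (setB q true)) with hK
  set Kp : (Fin m × Fin k → Bool) → ℝ := fun q => G (D (setB q false)) + G (D (setB q true)) with hKp
  have hKinv : ∀ f ∈ Bk, ∀ q v, K (Function.update q f v) = K q := by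
    intro f hf q v
    simp only [hK, hinv f hf]
  have hKabs : ∀ q, |K q| ≤ Kp q := fun q => by
    have h0 := hG (D (setB q false))
    have h1 := hG (D (setB q true))
    simp only [hK, hKp]
    rw [abs_le]
    constructor <;> linarith
  have hpt : ∀ q, G (D q) - G (fun d => xor (D q d) (P d)) = chiY Bk q * K q ∧
      G (D q) + G (fun d => xor (D q d) (P d)) = Kp q := by
    intro q
    have h0 := hD q (setB q false) (hagree q false)
    have h1 := hD q (setB q true) (hagree q true)
    rw [hpar] at h0 h1
    rw [chiY_eq_sgnR_parS]
    cases hq : parS Bk q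
    · rw [hq] at h0 h1
      simp only [if_true, Bool.true_eq_false, if_false] at h0 h1
      constructor
      · simp [hK, h0, h1, sgnR]
      · simp [hKp, h0, h1]
    · rw [hq] at h0 h1
      simp only [if_true, Bool.false_eq_true, if_false] at h0 h1
      constructor
      · simp [hK, h0, h1, sgnR]
      · simp [hKp, h0, h1, add_comm]
  calc |arrSum p (fun q => G (D q)) - arrSum p (fun q => G (fun d => xor (D q d) (P d)))|
      = |arrSum p (fun q => chiY Bk q * K q)| := by
        rw [arrSum_sub]
        exact congrArg (fun H => |arrSum p H|) (funext fun q => (hpt q).1)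
    _ = |∏ f ∈ Bk, (1 - 2 * p f.1)| * |arrSum p K| := by rw [arrSum_chiY_mul p Bk K hKinv, abs_mul]
    _ ≤ |∏ f ∈ Bk, (1 - 2 * p f.1)| * arrSum p Kp :=
        mul_le_mul_of_nonneg_left (abs_arrSum_le_arrSum_of_abs_le p hp K Kp hKabs) (abs_nonneg _)
    _ = |∏ f ∈ Bk, (1 - 2 * p f.1)| *
          (arrSum p (fun q => G (D q)) + arrSum p (fun q => G (fun d => xor (D q d) (P d)))) := by
        rw [arrSum_add_eq]
        exact congrArg (fun H => |∏ f ∈ Bk, (1 - 2 * p f.1)| * arrSum p H) (funext fun q => (hpt q).2).symm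

/-! ## Multiplicative chain of prefix flips -/

/-- MULTIPLICATIVE CHAIN OF FLIPS along prefix patterns: if `Φ ≥ 0` on nonnegative observables and XOR-ing
the pattern `[idx d ≤ t]` costs a factor `≤ R` (`R ≥ 1`) for every `t < L`, uniformly over nonnegative
observables, then XOR-ing `d ↦ a (idx d)` costs a factor `≤ R ^ L` whenever `a` vanishes from `L` on
(telescoping `a i = ⊕_{t ≥ i} (a t ⊕ a (t+1))`). [folklore] -/
theorem chain_flips_mul {δ : Type*} (Φ : ((δ → Bool) → ℝ) → ℝ)
    (hΦ : ∀ G : (δ → Bool) → ℝ, (∀ x, 0 ≤ G x) → 0 ≤ Φ G) (idx : δ → ℕ) (R : ℝ) (hR : 1 ≤ R)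
    (L : ℕ) (a : ℕ → Bool) (ha : ∀ i, L ≤ i → a i = false)
    (hcost : ∀ t, t < L → ∀ G : (δ → Bool) → ℝ, (∀ x, 0 ≤ G x) →
      Φ (fun x => G (fun d => xor (x d) (decide (idx d ≤ t)))) ≤ R * Φ G)
    (G : (δ → Bool) → ℝ) (hG : ∀ x, 0 ≤ G x) :
    Φ (fun x => G (fun d => xor (x d) (a (idx d)))) ≤ R ^ L * Φ G := by
  -- adapted from `ScreeningArray.chain_flips`: `pat t d = a (max (idx d) t)` interpolates between
  -- `a ∘ idx` (`t = 0`) and `false` (`t = L`)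
  suffices H : ∀ j, j ≤ L → ∀ t, t + j = L → ∀ G : (δ → Bool) → ℝ, (∀ x, 0 ≤ G x) →
      Φ (fun x => G (fun d => xor (x d) (a (max (idx d) t)))) ≤ R ^ j * Φ G by
    have := H L le_rfl 0 (zero_add L) G hG
    simpa using this
  intro j
  induction j with
  | zero =>
    intro _ t ht G hG
    have h0 : (fun x => G (fun d => xor (x d) (a (max (idx d) t)))) = G := by
      funext x
      congr 1
      funext d
      rw [ha _ (by omega), Bool.xor_false]
    rw [h0, pow_zero, one_mul]
  | succ j ih =>
    intro hj t ht G hG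
    have hR0 : 0 ≤ R := le_trans zero_le_one hR
    have ih' := ih (by omega) (t + 1) (by omega) G hG
    by_cases hat : a t = a (t + 1)
    · have hsame : ∀ d, a (max (idx d) t) = a (max (idx d) (t + 1)) := by
        intro d
        by_cases hd : idx d ≤ t
        · rw [max_eq_right hd, max_eq_right (by omega), hat]
        · rw [max_eq_left (by omega), max_eq_left (by omega)]
      simp only [hsame]
      calc _ ≤ R ^ j * Φ G := ih'
        _ ≤ R ^ (j + 1) * Φ G :=
            mul_le_mul_of_nonneg_right (pow_le_pow_right₀ hR (Nat.le_succ j)) (hΦ G hG)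
    · set G' : (δ → Bool) → ℝ := fun x => G (fun d => xor (x d) (a (max (idx d) (t + 1)))) with hG'
      have hG'0 : ∀ x, 0 ≤ G' x := fun x => hG _
      have hc := hcost t (by omega) G' hG'0
      have hstep : (fun x : δ → Bool => G' (fun d => xor (x d) (decide (idx d ≤ t)))) =
          fun x : δ → Bool => G (fun d => xor (x d) (a (max (idx d) t))) := by
        funext x
        simp only [hG']
        congr 1
        funext d
        by_cases hd : idx d ≤ t
        · rw [max_eq_right hd, max_eq_right (by omega), decide_eq_true hd]
          revert hat
          cases x d <;> cases a t <;> cases a (t + 1) <;> simp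
        · rw [max_eq_left (by omega), max_eq_left (by omega), decide_eq_false hd, Bool.xor_false]
      rw [hstep] at hc
      calc Φ (fun x => G (fun d => xor (x d) (a (max (idx d) t)))) ≤ R * Φ G' := hc
        _ ≤ R * (R ^ j * Φ G) := mul_le_mul_of_nonneg_left ih' hR0
        _ = R ^ (j + 1) * Φ G := by rw [pow_succ]; ring

/-! ## One elementary flip of the box data costs the factor `(1 + θ^n) / (1 - θ^n)` -/

/-- One elementary flip of the box data costs at most the factor `(1 + θ^n) / (1 - θ^n)` on nonnegative
statistics: columns. [folklore] -/
theorem colFlip_cost_mul (n w h : ℕ) (hn : 1 ≤ n) (p : Fin (w + 2 * n - 1) → ℝ) (θ : ℝ)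
    (hp : ∀ c, 0 ≤ p c ∧ p c ≤ 1) (hθ0 : 0 ≤ θ) (hθ1 : θ < 1) (hpθ : ∀ c, |1 - 2 * p c| ≤ θ)
    (t : ℕ) (ht : t < w) (G : (Fin w × Fin h → Bool) → ℝ) (hG : ∀ x, 0 ≤ G x) :
    arrSum (k := h + 2 * n - 1) p
        (fun q => G (fun ij => xor (boxData n w h q ij) (decide ((ij.1 : ℕ) ≤ t)))) ≤
      (1 + θ ^ n) / (1 - θ ^ n) * arrSum (k := h + 2 * n - 1) p (fun q => G (boxData n w h q)) := by
  -- adapted from `ScreeningArray.colFlip_cost`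
  set Bk := (univ.filter fun f : Fin (w + 2 * n - 1) × Fin (h + 2 * n - 1) =>
      (f.1 : ℕ) = n + t ∧ n + h - 1 ≤ (f.2 : ℕ)) with hBk
  have hf₀ : ((⟨n + t, by omega⟩, ⟨n + h - 1, by omega⟩) : Fin (w + 2 * n - 1) × Fin (h + 2 * n - 1)) ∈ Bk :=
    Finset.mem_filter.mpr ⟨mem_univ _, rfl, le_rfl⟩
  have hflip := flip_lemma_mul p hp Bk _ hf₀ (boxData n w h) (fun ij => decide ((ij.1 : ℕ) ≤ t))
    (fun q q' hqq => boxData_block n w h Bk _ (fun ij f hf => colBlock_pattern n w h t ij f hf) q q' hqq) G hG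
  have hρ := abs_prod_bias_le p θ hθ0 hθ1.le hpθ Bk n (colBlock_card n w h t hn ht)
  have hθn1 : θ ^ n < 1 := pow_lt_one₀ hθ0 hθ1 (by omega)
  exact le_ratio_mul_of_abs_sub_le (arrSum_nonneg_of_nonneg p hp _ fun q => hG _)
    (arrSum_nonneg_of_nonneg p hp _ fun q => hG _) hflip hρ hθn1

/-- One elementary flip of the box data costs at most the factor `(1 + θ^n) / (1 - θ^n)` on nonnegative
statistics: rows. [folklore] -/
theorem rowFlip_cost_mul (n w h : ℕ) (hn : 1 ≤ n) (p : Fin (w + 2 * n - 1) → ℝ) (θ : ℝ)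
    (hp : ∀ c, 0 ≤ p c ∧ p c ≤ 1) (hθ0 : 0 ≤ θ) (hθ1 : θ < 1) (hpθ : ∀ c, |1 - 2 * p c| ≤ θ)
    (t : ℕ) (ht : t < h) (G : (Fin w × Fin h → Bool) → ℝ) (hG : ∀ x, 0 ≤ G x) :
    arrSum (k := h + 2 * n - 1) p
        (fun q => G (fun ij => xor (boxData n w h q ij) (decide ((ij.2 : ℕ) ≤ t)))) ≤
      (1 + θ ^ n) / (1 - θ ^ n) * arrSum (k := h + 2 * n - 1) p (fun q => G (boxData n w h q)) := by
  -- adapted from `ScreeningArray.rowFlip_cost`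
  set Bk := (univ.filter fun f : Fin (w + 2 * n - 1) × Fin (h + 2 * n - 1) =>
      (f.2 : ℕ) = n + t ∧ n + w - 1 ≤ (f.1 : ℕ)) with hBk
  have hf₀ : ((⟨n + w - 1, by omega⟩, ⟨n + t, by omega⟩) : Fin (w + 2 * n - 1) × Fin (h + 2 * n - 1)) ∈ Bk :=
    Finset.mem_filter.mpr ⟨mem_univ _, rfl, le_rfl⟩
  have hflip := flip_lemma_mul p hp Bk _ hf₀ (boxData n w h) (fun ij => decide ((ij.2 : ℕ) ≤ t))
    (fun q q' hqq => boxData_block n w h Bk _ (fun ij f hf => rowBlock_pattern n w h t ij f hf) q q' hqq) G hG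
  have hρ := abs_prod_bias_le p θ hθ0 hθ1.le hpθ Bk n (rowBlock_card n w h t hn ht)
  have hθn1 : θ ^ n < 1 := pow_lt_one₀ hθ0 hθ1 (by omega)
  exact le_ratio_mul_of_abs_sub_le (arrSum_nonneg_of_nonneg p hp _ fun q => hG _)
    (arrSum_nonneg_of_nonneg p hp _ fun q => hG _) hflip hρ hθn1

/-! ## The registered stub -/

/-- REGISTERED STUB `screeningOffsetMul` (sub-goal of `stub_RatioMix`) — ADDITIVE OFFSETS COST A BOUNDED
FACTOR: on the `(w + 2n - 1) × (h + 2n - 1)` array of independent bits with column biases `p c`,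
`|1 - 2 p c| ≤ θ < 1`, XOR-ing the box data with an additive pattern `A i ⊕ B j` multiplies the expectation
of a NONNEGATIVE statistic `G` by at most `((1 + θ^n) / (1 - θ^n))^(w + h)`.
Proof: as for the additive `screeningOffset`, the offset is absorbed by `w` column-prefix flips and `h`
row-prefix flips of block parities (blocks of `≥ n` independent entries read only through their parity);
by the multiplicative flip lemma each flip changes `E[G]` by at most `ρ (E[G] + E[G'])`, `ρ ≤ θ^n`, i.e.
costs a factor `≤ (1 + θ^n)/(1 - θ^n)`. [folklore] -/
theorem screeningOffsetMul :
    ∀ (n w h : ℕ), 1 ≤ n → ∀ (p : Fin (w + 2 * n - 1) → ℝ) (θ : ℝ),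
      (∀ c, 0 ≤ p c ∧ p c ≤ 1) → 0 ≤ θ → θ < 1 → (∀ c, |1 - 2 * p c| ≤ θ) →
      ∀ (G : (Fin w × Fin h → Bool) → ℝ), (∀ t, 0 ≤ G t) → ∀ (A : Fin w → Bool) (B : Fin h → Bool),
      arrSum (k := h + 2 * n - 1) p
          (fun q => G (fun ij => xor (boxData n w h q ij) (xor (A ij.1) (B ij.2)))) ≤
        ((1 + θ ^ n) / (1 - θ ^ n)) ^ (w + h) * arrSum (k := h + 2 * n - 1) p (fun q => G (boxData n w h q)) := by
  intro n w h hn p θ hp hθ0 hθ1 hpθ G hG A B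
  set Φ : ((Fin w × Fin h → Bool) → ℝ) → ℝ :=
    fun G => arrSum (k := h + 2 * n - 1) p (fun q => G (boxData n w h q)) with hΦ
  have hθn1 : θ ^ n < 1 := pow_lt_one₀ hθ0 hθ1 (by omega)
  have hθn0 : 0 ≤ θ ^ n := pow_nonneg hθ0 n
  have hR1 : 1 ≤ (1 + θ ^ n) / (1 - θ ^ n) := by
    rw [le_div_iff₀ (sub_pos.mpr hθn1)]
    linarith
  have hR0 : 0 ≤ (1 + θ ^ n) / (1 - θ ^ n) := le_trans zero_le_one hR1
  have hΦ0 : ∀ G' : (Fin w × Fin h → Bool) → ℝ, (∀ x, 0 ≤ G' x) → 0 ≤ Φ G' := fun G' hG' =>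
    arrSum_nonneg_of_nonneg p hp _ fun q => hG' _
  -- column phase
  set a : ℕ → Bool := fun i => if hi : i < w then A ⟨i, hi⟩ else false with ha
  have ha0 : ∀ i, w ≤ i → a i = false := fun i hi => by simp [ha, not_lt.mpr hi]
  have hA := chain_flips_mul Φ hΦ0 (fun ij : Fin w × Fin h => (ij.1 : ℕ)) ((1 + θ ^ n) / (1 - θ ^ n)) hR1
    w a ha0 (fun t ht G' hG' => colFlip_cost_mul n w h hn p θ hp hθ0 hθ1 hpθ t ht G' hG') G hG
  have haA : ∀ ij : Fin w × Fin h, a (ij.1 : ℕ) = A ij.1 := fun ij => by simp [ha, ij.1.2]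
  simp only [haA] at hA
  -- row phase
  set G₁ : (Fin w × Fin h → Bool) → ℝ := fun x => G (fun ij => xor (x ij) (A ij.1)) with hG₁
  have hG₁0 : ∀ x, 0 ≤ G₁ x := fun x => hG _
  set b : ℕ → Bool := fun j => if hj : j < h then B ⟨j, hj⟩ else false with hb
  have hb0 : ∀ j, h ≤ j → b j = false := fun j hj => by simp [hb, not_lt.mpr hj]
  have hB := chain_flips_mul Φ hΦ0 (fun ij : Fin w × Fin h => (ij.2 : ℕ)) ((1 + θ ^ n) / (1 - θ ^ n)) hR1
    h b hb0 (fun t ht G' hG' => rowFlip_cost_mul n w h hn p θ hp hθ0 hθ1 hpθ t ht G' hG') G₁ hG₁0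
  have hbB : ∀ ij : Fin w × Fin h, b (ij.2 : ℕ) = B ij.2 := fun ij => by simp [hb, ij.2.2]
  simp only [hbB] at hB
  have hfin : (fun x : Fin w × Fin h → Bool => G₁ (fun ij => xor (x ij) (B ij.2))) =
      fun x => G (fun ij => xor (x ij) (xor (A ij.1) (B ij.2))) := by
    funext x
    simp only [hG₁]
    congr 1
    funext ij
    cases x ij <;> cases A ij.1 <;> cases B ij.2 <;> rfl
  rw [hfin] at hB
  calc Φ (fun x => G (fun ij => xor (x ij) (xor (A ij.1) (B ij.2))))
      ≤ ((1 + θ ^ n) / (1 - θ ^ n)) ^ h * Φ G₁ := hB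
    _ ≤ ((1 + θ ^ n) / (1 - θ ^ n)) ^ h * (((1 + θ ^ n) / (1 - θ ^ n)) ^ w * Φ G) :=
        mul_le_mul_of_nonneg_left hA (pow_nonneg hR0 h)
    _ = ((1 + θ ^ n) / (1 - θ ^ n)) ^ (w + h) * Φ G := by rw [pow_add]; ring

end Summit.CriticalPhenomena.CardyFormulaZ2.Theorems.IKLinearTransport.PinnedDiagramExchange.ScreeningAssembly
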